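import Literature.AlgebraicGeometry.Frobenioids.ModelFrobenioidRationalFunctionsProofs
import Literature.AlgebraicGeometry.Frobenioids.ModelFrobenioidIsFrobenioid
import Literature.AlgebraicGeometry.Frobenioids.BiratUnitsSubfunctor
import Literature.AlgebraicGeometry.Frobenioids.BirationalizationBiratData
import Literature.AlgebraicGeometry.Frobenioids.DivisorMonoidCategoryTheoreticityDefs
import Literature.AlgebraicGeometry.Frobenioids.BaseIdentityPreStepsSlim
import HarnessLib

/-!
# Frobenioids I, Theorem 5.2 (ii) "Moreover" ⟹ `Φ^birat = Div_B(B)` for a model Frobenioid, and the resulting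
# criterion for strict rationality (Def. 4.5 (ii)) at THE birationalization — PROOF

Mochizuki, *The geometry of Frobenioids I: the general theory*, Kyushu J. Math. **62** (2008) 293–400,
Theorem 5.2 (ii), kurims text p. 101: "there is a natural isomorphism of functors between the functor `O^×(−)` on
`D` associated to the Frobenioid `C^birat` [cf. Propositions 2.2, (ii), (iii); 4.4, (ii)] and the functor `B`;
this isomorphism is compatible with the homomorphisms `O^×(−) → Φ^gp` [cf. Proposition 4.4, (iii)],
`Div_B : B → Φ^gp`"; Definition 4.5 (ii), p. 86: "`A` is strictly rational if for every prime `𝔭 ∈ Prime(Φ(A))`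
there is an element `a − b ∈ Φ^birat(A)`, `a, b ∈ Φ(A)`, with `𝔭 ∈ Supp(a)`, `𝔭 ∉ Supp(b)`"; used in the
proofs of Thm. 6.2 (iii) (p. 112 l. 4–8 "it follows formally [cf. Definition 4.5, (ii)] that `C` is of [strictly]
rational type") and Thm. 6.4 (i) (p. 115 l. 21–22 "immediate from the definition of `B` that `C` is of [strictly]
rational type"), and of FrdII Thm. 1.2 (i). [cite: MochizukiFrdI2008, Thm. 5.2 (ii) p.101]

PROOF-ONLY (seat abc-iut-L6-t10 gen 2, S3 sub-DAG holder — the common input of rows T62iii/L08, T64i/L10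
(rational-type conjunct) and of M17). PROVED, for every model Frobenioid `(Φ, B, Div_B)` over `D` with `B`
group-like, `Φ` divisorial and `C → F_Φ` a Frobenioid (abc-iut-found's Thm. 5.2 (ii)):
* `ModelFrobenioid.mem_biratSubgroup_iff_exists_divB` — **`Φ^birat(A_D) = Div_B(B(A_D))`**: THE rational function
  monoid (abc-iut-L1-t5/L6-t8's canonical `PreFrobenioid.biratSubgroup`, the `phiBirat` of THE birationalization
  `PreFrobenioid.biratData`) at the base of an object `A` is the image of `Div_B` — from abc-iut-L6-t8's
  `range_divHom_eq_biratSubgroup` (Prop. 4.4 (iii): image of `O^×(A^birat) → Φ^gp` is `Φ^birat`, isotropic type)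
  and abc-iut-L1-t2's `rationalFunctionMonoidStr` (the "Moreover" isomorphism `B(A_D) ≅ O^×(A^birat)` compatible
  with `Div_B`, p408375);
* `ModelFrobenioid.isStrictlyRational_biratData_iff` — at THE birationalization and for ANY support predicate
  `Supp`, an object `A` is strictly rational iff for every prime `𝔭` of `Φ(A_D)` there are `a, b ∈ Φ(A_D)` and a
  rational function `f ∈ B(A_D)` with `[a] − [b] = Div_B(f)`, `𝔭 ∈ Supp(a)`, `𝔭 ∉ Supp(b)`;
* `ModelFrobenioid.isRational_of_isStrictlyRational` — strictly rational ⟹ rational (Def. 4.5 (ii), via the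
  identity pull-back morphism).
No definitions; nothing here bears on [IUTchIII] or asserts anything about abc.
-/

noncomputable section

namespace Literature.AlgebraicGeometry.Frobenioids

open CategoryTheory Opposite Function

namespace ModelFrobenioid

universe w v u

variable {D : Type u} [Category.{v} D] {Φ B : Dᵒᵖ ⥤ CommMonCat.{w}} {DivB : B ⟶ monoidGp Φ}
variable (hBg : Objectwise (fun M _ => IsGroupLike M) B)
  (hΦd : Objectwise (fun M _ => IsDivisorial M) Φ)
  (hF : PreFrobenioid.IsFrobenioid (toElem Φ B DivB))

include hBg hΦd hF

/-- **Thm. 5.2 (ii) "Moreover" ⟹ `Φ^birat(A_D) = Div_B(B(A_D))`** (FrdI p. 101): for a model Frobenioid, THE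
rational function monoid at the base `A_D` of an object `A` — the canonical `Φ^birat(A_D) ⊆ Φ^gp(A_D)` of
Prop. 4.4 (iii) — is the image of `Div_B : B(A_D) → Φ^gp(A_D)`: an element of `Φ^gp(A_D)` lies in
`Φ^birat(A_D)` iff it is the divisor of a rational function. [cite: MochizukiFrdI2008, Thm. 5.2 (ii) p.101] -/
theorem mem_biratSubgroup_iff_exists_divB (A : ModelFrobenioid Φ B DivB)
    (x : Algebra.GrothendieckGroup (Φ.obj (op (PreFrobenioid.baseObj (toElem Φ B DivB) A)))) :
    x ∈ PreFrobenioid.biratSubgroup (toElem Φ B DivB) (PreFrobenioid.baseObj (toElem Φ B DivB) A) ↔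
      ∃ f : B.obj (op (PreFrobenioid.baseObj (toElem Φ B DivB) A)),
        divB Φ B DivB (op (PreFrobenioid.baseObj (toElem Φ B DivB) A)) f = x := by
  rw [← PreFrobenioid.BiratUnits.range_divHom_eq_biratSubgroup hF A (isOfIsotropicType hBg), MonoidHom.mem_range]
  let S := rationalFunctionMonoidStr hBg hΦd hF
  constructor
  · rintro ⟨u, rfl⟩
    refine ⟨(S.iso A).symm u, ?_⟩
    have h := S.div_iso A ((S.iso A).symm u)
    rw [MulEquiv.apply_symm_apply] at h
    exact h.symm
  · rintro ⟨b, rfl⟩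
    exact ⟨S.iso A b, S.div_iso A b⟩

/-- **Definition 4.5 (ii) at THE birationalization of a model Frobenioid — CRITERION**: for any support
predicate `Supp` (the parameter of abc-iut-L1-t3's `IsStrictlyRational`; THE one is Def. 2.4 (i)(d)), an object
`A` is strictly rational w.r.t. THE birationalization datum `PreFrobenioid.biratData` iff for every prime `𝔭` of
`Φ(A_D)` there are `a, b ∈ Φ(A_D)` whose difference is the divisor `Div_B(f)` of a rational function
`f ∈ B(A_D)`, with `𝔭 ∈ Supp(a)` and `𝔭 ∉ Supp(b)` (FrdI p. 86; p. 112 l. 4–8; p. 115 l. 21–22).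
[cite: MochizukiFrdI2008, Def. 4.5 (ii) p.86] -/
theorem isStrictlyRational_biratData_iff (hsq : PreFrobenioid.HasBiratSquares (toElem Φ B DivB))
    (Supp : ∀ {X : D}, (data Φ B DivB).Mon X → Primes ((data Φ B DivB).Mon X) → Prop)
    (A : ModelFrobenioid Φ B DivB) :
    PreFrobenioidData.IsStrictlyRational (PreFrobenioid.biratData hF hsq) Supp A ↔
      ∀ 𝔭 : Primes (Φ.obj (op A.base)), ∃ a b : Φ.obj (op A.base),
        (∃ f : B.obj (op A.base),
            Algebra.GrothendieckGroup.of a / Algebra.GrothendieckGroup.of b = divB Φ B DivB (op A.base) f) ∧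
          Supp a 𝔭 ∧ ¬ Supp b 𝔭 := by
  refine forall_congr' fun 𝔭 => exists_congr fun a => exists_congr fun b => and_congr_left fun _ => ?_
  exact (mem_biratSubgroup_iff_exists_divB hBg hΦd hF A _).trans (exists_congr fun f => eq_comm)

omit hBg hΦd in
/-- **Definition 4.5 (ii)**: a strictly rational object is rational (take the identity as the pull-back morphism;
`𝟙` is a pull-back morphism in a Frobenioid). [cite: MochizukiFrdI2008, Def. 4.5 (ii) p.86] -/
theorem isRational_of_isStrictlyRational (hsq : PreFrobenioid.HasBiratSquares (toElem Φ B DivB))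
    (Supp : ∀ {X : D}, (data Φ B DivB).Mon X → Primes ((data Φ B DivB).Mon X) → Prop)
    (A : ModelFrobenioid Φ B DivB)
    (h : PreFrobenioidData.IsStrictlyRational (PreFrobenioid.biratData hF hsq) Supp A) :
    PreFrobenioidData.IsRational (PreFrobenioid.biratData hF hsq) Supp A :=
  ⟨A, 𝟙 A, PreFrobenioidData.isPullbackMorphism_id (data Φ B DivB) A, h⟩

end ModelFrobenioid

end Literature.AlgebraicGeometry.Frobenioids

end
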